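import Summits.QuantumFields.BalabanUV.T4Continuum.Support.GradientRowSumTransport
import Summits.QuantumFields.BalabanUV.T4Continuum.Support.CTScalarGreen

/-!
# G-an2-4 ∕ (CONV-C), the SCALAR second-order sup letters — part 2: THE SCALAR AVERAGED PROPAGATOR `𝒢′ = (Δ + a′Π′)⁻¹` ON THE
# NE3 CARRIER (`Gps ⊗ 1` read through `eF`): it inverts `stencilE + (a′/n²)·(Π′ ⊗ 1)` and its mass term is
# block-diagonal with cube rows `a′·n⁻²` — the hypotheses of the abstract flat resolvent step, for the scalar operator

G-an2-4 formalisation swarm `b2b-balaban-gan24-formalise-*`, leaf prover 06 (gen 35), crux team (2) under the coordinator ruling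
«YM REDIRECT» (e34b3e0c).  WHY — the road-P2 crux prover's consumer (`GAN24/StaircaseLaplacianDefect` p253982 → the announced
`SoftMinimiserOneStepSup`) costs `‖𝒢′∂′ᴴ∂′ᴴ‖_{∞→∞}` and `‖𝒢′∂′ᴴ‖_{∞→∞}` for NE2's SCALAR averaged propagator
`𝒢′ = ScalarAveragedPropagator.Gps n M a′ = (LapS + a′•Π′)⁻¹` (`η`-lattice normalisation, `LapS = n²·Δ_unit`).  Part 1 of this line
(`GAN24/FlatResolventStep`, abstract) turns a ZEROTH-order cube-row bound for ANY inverse `Gs` of `stencilE + Ms` on the NE3 carrier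
`(ℤ/NL^k)^{d+1} × Fin (d+1)` into first- and second-order cube-row bounds (`n`, `1 + log n`).  THIS FILE is the dictionary that
lets part 1 act on the scalar `𝒢′`: the lift `A ↦ RI j (A ⊗ₖ 1)` of a real matrix on Bałaban's fine torus
`Tor (fine n M)` (`n = L^{min(j,k)}`, `M ≡ N·L^{k−j}`) to the NE3 carrier (diagonal in the internal index).
 * §1 lift algebra: entries, products, unit, sums, scalars; **`sum_cube_eq_sum_bpt`** (a level-`j` cube of the NE3 torus IS a
   Bałaban block `{n·ȳ + r}`), **`cubeSum_RI_kron`** (cube rows of a lift = block rows of the matrix);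
 * §2 **`scaled_LapS_kron_eq_stencil`**: `n⁻²·RI j (Re LapS ⊗ 1) = stencilE` (the scalar twin of NE3 part 3's
   `scaled_LapR_eq_stencil`);
 * §3 the mass term `Ms = (a′/n²)·RI j (Re Π′ ⊗ 1)`: entries `n^{−(d+1)}·[same cube, same index]`, cube rows
   `= (a′/n²)·[cube x = b] ≤ a′·(L^j)⁻²·e^{−δ·nbd}` for EVERY rate `δ` (**`cubeSum_mass_le`**);
 * §4 realness of `Π′`, `Δ′ = DeltaPs`, `𝒢′ = Gps`; **`scaledDeltaPs_kron_eq`** `n⁻²·RI j (Re Δ′ ⊗ 1) = stencilE + Ms` and the two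
   inverse identities **`Ks_mul_Gs`**, **`Gs_mul_Ks`** for `Gs = n²·RI j (Re 𝒢′ ⊗ 1)` — the hypotheses of part 1's
   `resolventStep_bounds`;
 * (the two DICTIONARIES — zeroth-order block rows of `𝒢′` IN, column differences of `Gs` OUT as entries of `𝒢′∂ᴴ`,
   `𝒢′∂ᴴ∂ᴴ` — are the sequel `GAN24/ScalarFlatDictionary`.)

HONEST SCOPE.  [folklore] finite-dimensional bookkeeping (reindexing, Kronecker products, block sums) over tree modules BY NAME; no
estimate is proved here; no `def`, no `def … : Prop`, no `sorry`.
NOT (CONV-C), NEVER «G-an2-4 closed», NOT NE2 ∕ NE3, NOT D1, NOT BetaPertH, NOT continuum, NOT Clay; not in print — our bookkeeping.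
ABSOLUTE RULE of the cell kept.  HONEST DEPENDENCY: continuum YM on T⁴ ⇐ BetaPertH ∧ nine spine estimates (0/9 proved); BetaPertH ⇐
(D1) ∧ (D4) ∧ CAP+tail; G-an2-4 gates asym, D1 and NE2/3/4.
-/

noncomputable section

open scoped BigOperators ComplexConjugate Matrix Kronecker
open Finset

namespace Summit.QuantumFields.BalabanUV.Beta.GAN24.ScalarFlatLift

open Literature.MathematicalPhysics.QuantumFieldTheory.Balaban1983to89
open Literature.MathematicalPhysics.QuantumFieldTheory.Balaban1983to89.TreeLengthTorus (TPt)
open Literature.MathematicalPhysics.QuantumFieldTheory.Balaban1983to89.B5Prop11Plancherel (Tor fine unitVec)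
open Literature.MathematicalPhysics.QuantumFieldTheory.Balaban1983to89.B5Action121 (sdiff LapS sdiff_mulVec)
open Literature.MathematicalPhysics.QuantumFieldTheory.Balaban1983to89.B5Block118 (bpt)
open Literature.MathematicalPhysics.QuantumFieldTheory.Balaban1983to89.B5Blocks16 (blockOf_bpt bpt_bijective)
open Literature.MathematicalPhysics.QuantumFieldTheory.Balaban1983to89.B6LowerBound2153Torus (toT)
open Literature.MathematicalPhysics.QuantumFieldTheory.Balaban1983to89.B4TorusKernel.MultiPeriod (torusSupNorm)
open Literature.MathematicalPhysics.QuantumFieldTheory.Balaban1983to89.B5RealFields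
  (IsReal reM reM_add reM_smul_ofReal reM_one isReal_LapS isReal_QsOp)
open Summit.QuantumFields.BalabanUV.T4Continuum
open Summit.QuantumFields.BalabanUV.T4Continuum.SliceTorusBlocks (npl1)
open SliceTorusTower SliceCovariantTower SliceFlatPropagator SliceFlatOperators SliceFlatStencil
open Summit.QuantumFields.BalabanUV.T4Continuum.SliceFlatFreeResolvent (rowDiff)
open Summit.QuantumFields.BalabanUV.T4Continuum.SliceFlatGradientPrep (colDiff mul_colDiff_apply)
open Summit.QuantumFields.BalabanUV.T4Continuum.GradientRowSumTransport (blockOf_eF)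
open Summit.QuantumFields.BalabanUV.T4Continuum.ScalarBlockPoincare (PiS)
open Summit.QuantumFields.BalabanUV.T4Continuum.ScalarAveragedPropagator (DeltaPs Gps DeltaPs_mul_Gps Gps_mul_DeltaPs)
open Summit.QuantumFields.BalabanUV.T4Continuum.CTScalarGreen (LapS_apply)
open Summit.QuantumFields.BalabanUV.T4Continuum.ScalarCovariantCTDefects (PiS_apply)

variable (d k N L : ℕ) [NeZero N] [NeZero L]

/-! ## §1  The lift `A ↦ RI j (A ⊗ₖ 1)` of a real scalar-carrier matrix to the NE3 carrier -/
section Lift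

variable (j : ℕ)

omit [NeZero N] [NeZero L] in
/-- **Entries of the lift**: `RI j (A ⊗ 1) p q = [p₂ = q₂]·A(eF p₁, eF q₁)`. [folklore] -/
theorem RI_kron_apply (A : Matrix (Tor (fine (side k L j) (Mlev d k N L j))) (Tor (fine (side k L j) (Mlev d k N L j))) ℝ)
    (p q : TPt (d + 1) (N * L ^ k) × Fin (d + 1)) :
    RI d k N L j (A ⊗ₖ (1 : Matrix (Fin (d + 1)) (Fin (d + 1)) ℝ)) p q
      = if p.2 = q.2 then A (eF d k N L j p.1) (eF d k N L j q.1) else 0 := by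
  rw [RI_apply, Matrix.kroneckerMap_apply, Matrix.one_apply, mul_ite, mul_one, mul_zero]

/-- The lift is multiplicative. [folklore] -/
theorem RI_kron_mul (A B : Matrix (Tor (fine (side k L j) (Mlev d k N L j))) (Tor (fine (side k L j) (Mlev d k N L j))) ℝ) :
    RI d k N L j (A ⊗ₖ (1 : Matrix (Fin (d + 1)) (Fin (d + 1)) ℝ)) * RI d k N L j (B ⊗ₖ (1 : Matrix (Fin (d + 1)) (Fin (d + 1)) ℝ))
      = RI d k N L j ((A * B) ⊗ₖ (1 : Matrix (Fin (d + 1)) (Fin (d + 1)) ℝ)) := by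
  rw [← RI_mul, ← Matrix.mul_kronecker_mul, Matrix.mul_one]

omit [NeZero N] [NeZero L] in
/-- The lift of the identity is the identity. [folklore] -/
theorem RI_kron_one :
    RI d k N L j ((1 : Matrix (Tor (fine (side k L j) (Mlev d k N L j))) (Tor (fine (side k L j) (Mlev d k N L j))) ℝ)
      ⊗ₖ (1 : Matrix (Fin (d + 1)) (Fin (d + 1)) ℝ)) = 1 := by
  rw [Matrix.one_kronecker_one, RI_one]

omit [NeZero N] [NeZero L] in
/-- The lift is additive. [folklore] -/
theorem RI_kron_add (A B : Matrix (Tor (fine (side k L j) (Mlev d k N L j))) (Tor (fine (side k L j) (Mlev d k N L j))) ℝ) :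
    RI d k N L j ((A + B) ⊗ₖ (1 : Matrix (Fin (d + 1)) (Fin (d + 1)) ℝ))
      = RI d k N L j (A ⊗ₖ (1 : Matrix (Fin (d + 1)) (Fin (d + 1)) ℝ)) + RI d k N L j (B ⊗ₖ (1 : Matrix (Fin (d + 1)) (Fin (d + 1)) ℝ)) := by
  rw [Matrix.add_kronecker, RI_add]

omit [NeZero N] [NeZero L] in
/-- The lift is homogeneous. [folklore] -/
theorem RI_kron_smul (c : ℝ) (A : Matrix (Tor (fine (side k L j) (Mlev d k N L j))) (Tor (fine (side k L j) (Mlev d k N L j))) ℝ) :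
    RI d k N L j ((c • A) ⊗ₖ (1 : Matrix (Fin (d + 1)) (Fin (d + 1)) ℝ))
      = c • RI d k N L j (A ⊗ₖ (1 : Matrix (Fin (d + 1)) (Fin (d + 1)) ℝ)) := by
  rw [Matrix.smul_kronecker, RI_smul]

/-- **A level-`j` cube of the NE3 torus IS a Bałaban block**: a sum over `{z : cube j z = b}`, read through `eF`, is the sum over
the block points `n·b̄ + r`, `0 ≤ r_μ < n` ([B5] (1.6), pv15's `bpt`). [folklore] -/
theorem sum_cube_eq_sum_bpt (f : Tor (fine (side k L j) (Mlev d k N L j)) → ℝ) (b : TPt (d + 1) (levM k N L j)) :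
    ∑ z ∈ Finset.univ.filter (fun z : TPt (d + 1) (N * L ^ k) => cube (d + 1) k N L j z = b), f (eF d k N L j z)
      = ∑ r : Fin (d + 1) → Fin (side k L j), f (bpt (side k L j) (Mlev d k N L j) b r) := by
  rw [Finset.sum_filter]
  have h1 : (∑ z : TPt (d + 1) (N * L ^ k), if cube (d + 1) k N L j z = b then f (eF d k N L j z) else 0)
      = ∑ x : Tor (fine (side k L j) (Mlev d k N L j)),
          if B5Blocks16.blockOf (side k L j) (Mlev d k N L j) x = b then f x else 0 := by
    rw [← Equiv.sum_comp (eF d k N L j)]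
    simp_rw [blockOf_eF]
  rw [h1, ← (bpt_bijective (side k L j) (Mlev d k N L j)).sum_comp, Fintype.sum_prod_type]
  simp only [blockOf_bpt]
  rw [Finset.sum_eq_single b]
  · simp
  · intro y _ hy
    simp [hy]
  · intro h; exact absurd (Finset.mem_univ _) h

/-- **Cube rows of a lift are block rows of the matrix**:
`Σ_{q ∈ Δ_j(b)} |RI j (A ⊗ 1)(p,q)| = Σ_r |A(eF p₁, n·b̄ + r)|`. [folklore] -/
theorem cubeSum_RI_kron (A : Matrix (Tor (fine (side k L j) (Mlev d k N L j))) (Tor (fine (side k L j) (Mlev d k N L j))) ℝ)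
    (p : TPt (d + 1) (N * L ^ k) × Fin (d + 1)) (b : TPt (d + 1) (levM k N L j)) :
    ∑ q ∈ Finset.univ.filter (fun q => cubeI (d + 1) k N L (Fin (d + 1)) j q = b),
        |RI d k N L j (A ⊗ₖ (1 : Matrix (Fin (d + 1)) (Fin (d + 1)) ℝ)) p q|
      = ∑ r : Fin (d + 1) → Fin (side k L j), |A (eF d k N L j p.1) (bpt (side k L j) (Mlev d k N L j) b r)| := by
  rw [← sum_cube_eq_sum_bpt d k N L j (fun x => |A (eF d k N L j p.1) x|) b, Finset.sum_filter, Finset.sum_filter,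
    Fintype.sum_prod_type]
  refine Finset.sum_congr rfl fun z _ => ?_
  simp only [cubeI_apply, RI_kron_apply]
  split_ifs with h
  · rw [Finset.sum_eq_single p.2]
    · rw [if_pos rfl]
    · intro c _ hc
      rw [if_neg (Ne.symm hc), abs_zero]
    · intro h'; exact absurd (Finset.mem_univ _) h'
  · simp

end Lift

/-! ## §2  The scalar Laplacian IS the stencil -/
section Stencil

variable (j : ℕ)

omit [NeZero N] [NeZero L] in
/-- A `{0,1}`-valued complex indicator is the cast of the real one. [folklore] -/
theorem ite_cast (c : Prop) [Decidable c] : (if c then (1 : ℂ) else 0) = ((if c then (1 : ℝ) else 0 : ℝ) : ℂ) := by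
  split_ifs <;> simp

/-- **`n⁻² · RI j (Re Δ ⊗ 1) = stencilE` FOR EVERY LEVEL `j`** (`Δ = LapS (fine n M) n`, the `η`-lattice scalar Laplacian of
[B5] (1.21), pv15's typed object, `n = L^{min(j,k)}`): the scalar twin of NE3 part 3's `scaled_LapR_eq_stencil`. [folklore] -/
theorem scaled_LapS_kron_eq_stencil :
    ((side k L j : ℝ) ^ 2)⁻¹ • RI d k N L j
        (reM (LapS (fine (side k L j) (Mlev d k N L j)) ((side k L j : ℕ) : ℂ)) ⊗ₖ (1 : Matrix (Fin (d + 1)) (Fin (d + 1)) ℝ))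
      = stencilE d k N L := by
  have hn : ((side k L j : ℝ) ^ 2) ≠ 0 := by have := one_le_side k L j; positivity
  ext p q
  rw [Matrix.smul_apply, RI_kron_apply, smul_eq_mul, stencilE]
  by_cases hc : p.2 = q.2
  · rw [if_pos hc]
    have hre : reM (LapS (fine (side k L j) (Mlev d k N L j)) ((side k L j : ℕ) : ℂ)) (eF d k N L j p.1) (eF d k N L j q.1)
        = (side k L j : ℝ) ^ 2 * ∑ ν : Fin (d + 1),
            (2 * (if eF d k N L j p.1 = eF d k N L j q.1 then (1 : ℝ) else 0)
              - (if eF d k N L j p.1 + unitVec (fine (side k L j) (Mlev d k N L j)) ν = eF d k N L j q.1 then (1 : ℝ) else 0)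
              - (if eF d k N L j p.1 - unitVec (fine (side k L j) (Mlev d k N L j)) ν = eF d k N L j q.1 then (1 : ℝ) else 0)) := by
      rw [reM, Matrix.map_apply, LapS_apply]
      have e : (∑ ν : Fin (d + 1), conj ((side k L j : ℕ) : ℂ) * ((side k L j : ℕ) : ℂ) *
          (2 * (if eF d k N L j p.1 = eF d k N L j q.1 then (1 : ℂ) else 0)
            - (if eF d k N L j p.1 + unitVec (fine (side k L j) (Mlev d k N L j)) ν = eF d k N L j q.1 then (1 : ℂ) else 0)
            - (if eF d k N L j p.1 - unitVec (fine (side k L j) (Mlev d k N L j)) ν = eF d k N L j q.1 then (1 : ℂ) else 0)))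
          = (((side k L j : ℝ) ^ 2 * ∑ ν : Fin (d + 1),
            (2 * (if eF d k N L j p.1 = eF d k N L j q.1 then (1 : ℝ) else 0)
              - (if eF d k N L j p.1 + unitVec (fine (side k L j) (Mlev d k N L j)) ν = eF d k N L j q.1 then (1 : ℝ) else 0)
              - (if eF d k N L j p.1 - unitVec (fine (side k L j) (Mlev d k N L j)) ν = eF d k N L j q.1 then (1 : ℝ) else 0)) : ℝ) : ℂ) := by
        rw [Complex.conj_natCast]
        simp_rw [ite_cast]
        push_cast
        rw [Finset.mul_sum]
        exact Finset.sum_congr rfl fun ν _ => by ring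
      rw [e, Complex.ofReal_re]
    rw [hre, ← mul_assoc, inv_mul_cancel₀ hn, one_mul]
    refine Finset.sum_congr rfl fun ν _ => ?_
    obtain ⟨h1, h2⟩ := eF_step_eq_iff d k N L j ν p q
    have e0 : (eF d k N L j p.1 = eF d k N L j q.1) ↔ p = q := by
      rw [(eF d k N L j).apply_eq_iff_eq]
      constructor
      · intro h; exact Prod.ext h hc
      · rintro rfl; rfl
    have e1 : (eF d k N L j p.1 + unitVec (fine (side k L j) (Mlev d k N L j)) ν = eF d k N L j q.1)
        ↔ (p.1 + Pi.single ν 1, p.2) = q := by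
      rw [← h1, Prod.mk.injEq]; exact ⟨fun h => ⟨h, hc⟩, fun h => h.1⟩
    have e2 : (eF d k N L j p.1 - unitVec (fine (side k L j) (Mlev d k N L j)) ν = eF d k N L j q.1)
        ↔ (p.1 - Pi.single ν 1, p.2) = q := by
      rw [← h2, Prod.mk.injEq]; exact ⟨fun h => ⟨h, hc⟩, fun h => h.1⟩
    simp only [kd, e0, e1, e2]
    ring
  · rw [if_neg hc, mul_zero]
    symm
    refine Finset.sum_eq_zero fun ν _ => ?_
    have k0 : kd d k N L p q = 0 := by
      rw [kd, if_neg]; rintro rfl; exact hc rfl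
    have k1 : kd d k N L (p.1 + Pi.single ν 1, p.2) q = 0 := by
      rw [kd, if_neg]; intro h; exact hc (by rw [← h])
    have k2 : kd d k N L (p.1 - Pi.single ν 1, p.2) q = 0 := by
      rw [kd, if_neg]; intro h; exact hc (by rw [← h])
    rw [k0, k1, k2]; ring

end Stencil

/-! ## §3  The block-averaging mass term on the carrier -/
section Mass

variable (j : ℕ)

/-- **Entries of the lifted block projection**: `RI j (Re Π′ ⊗ 1) p q = [p₂ = q₂]·[cube p₁ = cube q₁]·n^{−(d+1)}`. [folklore] -/
theorem RI_PiS_kron_apply (p q : TPt (d + 1) (N * L ^ k) × Fin (d + 1)) :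
    RI d k N L j (reM (PiS (side k L j) (Mlev d k N L j)) ⊗ₖ (1 : Matrix (Fin (d + 1)) (Fin (d + 1)) ℝ)) p q
      = if p.2 = q.2 ∧ cube (d + 1) k N L j p.1 = cube (d + 1) k N L j q.1 then (((side k L j : ℝ)) ^ (d + 1))⁻¹ else 0 := by
  rw [RI_kron_apply, reM, Matrix.map_apply, PiS_apply, blockOf_eF, blockOf_eF]
  by_cases hc : p.2 = q.2
  · rw [if_pos hc]
    by_cases hb : cube (d + 1) k N L j p.1 = cube (d + 1) k N L j q.1
    · rw [if_pos hb, if_pos ⟨hc, hb⟩]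
      have e : (1 / ((side k L j : ℕ) : ℂ) ^ (d + 1)) = (((((side k L j : ℝ)) ^ (d + 1))⁻¹ : ℝ) : ℂ) := by
        push_cast; rw [one_div]
      rw [e, Complex.ofReal_re]
    · rw [if_neg hb, if_neg (fun h => hb h.2), Complex.zero_re]
  · rw [if_neg hc, if_neg (fun h => hc h.1)]

omit [NeZero N] [NeZero L] in
/-- The ℓ¹ block distance of a block to itself vanishes. [folklore] -/
theorem nbd_self (b : TPt (d + 1) (levM k N L j)) : nbd (d + 1) k N L j b b = 0 := by
  simp [nbd, npl1]

/-- **Cube rows of the mass term `Ms = (a′/n²)·RI j (Re Π′ ⊗ 1)`**: for `j ≤ k`, every rate `δ`, every row `x` and every cube `b`,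
`Σ_{z ∈ Δ_j(b)} |Ms(x,z)| ≤ a′·(L^j)⁻²·e^{−δ·nbd_j(Δ(x), b)}` (the sum is `(a′/n²)·[Δ(x) = b]`: the mass term is block-diagonal). [folklore] -/
theorem cubeSum_mass_le {a' : ℝ} (ha' : 0 ≤ a') {j : ℕ} (hj : j ≤ k) (δ : ℝ)
    (x : TPt (d + 1) (N * L ^ k) × Fin (d + 1)) (b : TPt (d + 1) (levM k N L j)) :
    ∑ z ∈ Finset.univ.filter (fun z => cubeI (d + 1) k N L (Fin (d + 1)) j z = b),
        |((a' * ((side k L j : ℝ) ^ 2)⁻¹) • RI d k N L j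
            (reM (PiS (side k L j) (Mlev d k N L j)) ⊗ₖ (1 : Matrix (Fin (d + 1)) (Fin (d + 1)) ℝ))) x z|
      ≤ a' * (((L : ℝ) ^ j) ^ 2)⁻¹ * Real.exp (-(δ * nbd (d + 1) k N L j (cubeI (d + 1) k N L (Fin (d + 1)) j x) b)) := by
  have hn1 := one_le_side k L j
  have hn : (0 : ℝ) < (side k L j : ℝ) := by exact_mod_cast hn1
  have hside : ((side k L j : ℕ) : ℝ) = (L : ℝ) ^ j := by rw [side, min_eq_left hj, Nat.cast_pow]
  have hc0 : 0 ≤ a' * ((side k L j : ℝ) ^ 2)⁻¹ := by positivity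
  -- pull the scalar out and read the cube row as a block row
  have h1 : ∑ z ∈ Finset.univ.filter (fun z => cubeI (d + 1) k N L (Fin (d + 1)) j z = b),
        |((a' * ((side k L j : ℝ) ^ 2)⁻¹) • RI d k N L j
            (reM (PiS (side k L j) (Mlev d k N L j)) ⊗ₖ (1 : Matrix (Fin (d + 1)) (Fin (d + 1)) ℝ))) x z|
      = a' * ((side k L j : ℝ) ^ 2)⁻¹ * ∑ z ∈ Finset.univ.filter (fun z => cubeI (d + 1) k N L (Fin (d + 1)) j z = b),
          |RI d k N L j (reM (PiS (side k L j) (Mlev d k N L j)) ⊗ₖ (1 : Matrix (Fin (d + 1)) (Fin (d + 1)) ℝ)) x z| := by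
    rw [Finset.mul_sum]
    refine Finset.sum_congr rfl fun z _ => ?_
    rw [Matrix.smul_apply, smul_eq_mul, abs_mul, abs_of_nonneg hc0]
  -- the block row of the lifted projection: `[cube x₁ = b]`
  have h2 : ∑ z ∈ Finset.univ.filter (fun z => cubeI (d + 1) k N L (Fin (d + 1)) j z = b),
        |RI d k N L j (reM (PiS (side k L j) (Mlev d k N L j)) ⊗ₖ (1 : Matrix (Fin (d + 1)) (Fin (d + 1)) ℝ)) x z|
      = if cube (d + 1) k N L j x.1 = b then 1 else 0 := by
    rw [cubeSum_RI_kron]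
    have hr : ∀ r : Fin (d + 1) → Fin (side k L j),
        |reM (PiS (side k L j) (Mlev d k N L j)) (eF d k N L j x.1) (bpt (side k L j) (Mlev d k N L j) b r)|
          = if cube (d + 1) k N L j x.1 = b then (((side k L j : ℝ)) ^ (d + 1))⁻¹ else 0 := by
      intro r
      rw [reM, Matrix.map_apply, PiS_apply, blockOf_eF, blockOf_bpt]
      split_ifs with h
      · have e : (1 / ((side k L j : ℕ) : ℂ) ^ (d + 1)) = (((((side k L j : ℝ)) ^ (d + 1))⁻¹ : ℝ) : ℂ) := by
          push_cast; rw [one_div]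
        rw [e, Complex.ofReal_re, abs_of_nonneg (by positivity)]
      · rw [Complex.zero_re, abs_zero]
    simp_rw [hr]
    rw [Finset.sum_const, Finset.card_univ, Fintype.card_pi, Finset.prod_const, Finset.card_univ, Fintype.card_fin,
      Fintype.card_fin]
    split_ifs
    · rw [nsmul_eq_mul, Nat.cast_pow, mul_inv_cancel₀ (by positivity)]
    · rw [smul_zero]
  rw [h1, h2]
  by_cases hb : cube (d + 1) k N L j x.1 = b
  · rw [if_pos hb, mul_one, cubeI_apply, hb, nbd_self, Nat.cast_zero, mul_zero, neg_zero, Real.exp_zero, mul_one, hside]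
  · rw [if_neg hb, mul_zero]
    have : 0 ≤ a' * (((L : ℝ) ^ j) ^ 2)⁻¹ := by positivity
    positivity

end Mass

/-! ## §4  The scalar operator and its inverse on the carrier -/
section Operator

variable {D : ℕ} (n : ℕ) [NeZero n] (M : Fin D → ℕ) [∀ μ, NeZero (M μ)]

omit [NeZero n] in
/-- `Π′` is a real matrix. [folklore] -/
theorem isReal_PiS : IsReal (PiS n M) :=
  ((isReal_QsOp n M).conjTranspose.mul (isReal_QsOp n M)).smul (by simp)

/-- `Δ′ = Δ + a′Π′` is a real matrix. [folklore] -/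
theorem isReal_DeltaPs (a' : ℝ) : IsReal (DeltaPs n M a') :=
  (isReal_LapS (fine n M) (Complex.conj_natCast n)).add ((isReal_PiS n M).smul (Complex.conj_ofReal a'))

/-- `𝒢′ = (Δ + a′Π′)⁻¹` is a real matrix. [folklore] -/
theorem isReal_Gps (a' : ℝ) : IsReal (Gps n M a') := (isReal_DeltaPs n M a').inv

variable (j : ℕ)

/-- **THE SCALAR OPERATOR ON THE CARRIER**: `n⁻²·RI j (Re Δ′ ⊗ 1) = stencilE + (a′/n²)·RI j (Re Π′ ⊗ 1)`. [folklore] -/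
theorem scaledDeltaPs_kron_eq (a' : ℝ) :
    ((side k L j : ℝ) ^ 2)⁻¹ • RI d k N L j
        (reM (DeltaPs (side k L j) (Mlev d k N L j) a') ⊗ₖ (1 : Matrix (Fin (d + 1)) (Fin (d + 1)) ℝ))
      = stencilE d k N L + (a' * ((side k L j : ℝ) ^ 2)⁻¹) • RI d k N L j
          (reM (PiS (side k L j) (Mlev d k N L j)) ⊗ₖ (1 : Matrix (Fin (d + 1)) (Fin (d + 1)) ℝ)) := by
  rw [DeltaPs, reM_add, reM_smul_ofReal, RI_kron_add, smul_add, scaled_LapS_kron_eq_stencil, RI_kron_smul, smul_smul,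
    mul_comm (((side k L j : ℝ)) ^ 2)⁻¹ a']

/-- **`K·G = 1` ON THE CARRIER**: `(n⁻²·RI j (Re Δ′ ⊗ 1))·(n²·RI j (Re 𝒢′ ⊗ 1)) = 1` (`a′ > 0`). [folklore] -/
theorem Ks_mul_Gs {a' : ℝ} (ha' : 0 < a') :
    (((side k L j : ℝ) ^ 2)⁻¹ • RI d k N L j
        (reM (DeltaPs (side k L j) (Mlev d k N L j) a') ⊗ₖ (1 : Matrix (Fin (d + 1)) (Fin (d + 1)) ℝ)))
      * (((side k L j : ℝ) ^ 2) • RI d k N L j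
        (reM (Gps (side k L j) (Mlev d k N L j) a') ⊗ₖ (1 : Matrix (Fin (d + 1)) (Fin (d + 1)) ℝ))) = 1 := by
  have hn : ((side k L j : ℝ) ^ 2) ≠ 0 := by have := one_le_side k L j; positivity
  rw [Matrix.smul_mul, Matrix.mul_smul, smul_smul, inv_mul_cancel₀ hn, one_smul, RI_kron_mul,
    ← (isReal_DeltaPs _ _ a').reM_mul (isReal_Gps _ _ a'), DeltaPs_mul_Gps _ _ ha', reM_one, RI_kron_one]

/-- **`G·K = 1` ON THE CARRIER**. [folklore] -/
theorem Gs_mul_Ks {a' : ℝ} (ha' : 0 < a') :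
    (((side k L j : ℝ) ^ 2) • RI d k N L j
        (reM (Gps (side k L j) (Mlev d k N L j) a') ⊗ₖ (1 : Matrix (Fin (d + 1)) (Fin (d + 1)) ℝ)))
      * (((side k L j : ℝ) ^ 2)⁻¹ • RI d k N L j
        (reM (DeltaPs (side k L j) (Mlev d k N L j) a') ⊗ₖ (1 : Matrix (Fin (d + 1)) (Fin (d + 1)) ℝ))) = 1 := by
  have hn : ((side k L j : ℝ) ^ 2) ≠ 0 := by have := one_le_side k L j; positivity
  rw [Matrix.smul_mul, Matrix.mul_smul, smul_smul, mul_inv_cancel₀ hn, one_smul, RI_kron_mul,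
    ← (isReal_Gps _ _ a').reM_mul (isReal_DeltaPs _ _ a'), Gps_mul_DeltaPs _ _ ha', reM_one, RI_kron_one]

/-- The two inverse identities in part 1's form `(stencilE + Ms)·Gs = 1 = Gs·(stencilE + Ms)`. [folklore] -/
theorem stencil_add_mass_mul_Gs {a' : ℝ} (ha' : 0 < a') :
    (stencilE d k N L + (a' * ((side k L j : ℝ) ^ 2)⁻¹) • RI d k N L j
        (reM (PiS (side k L j) (Mlev d k N L j)) ⊗ₖ (1 : Matrix (Fin (d + 1)) (Fin (d + 1)) ℝ)))
      * (((side k L j : ℝ) ^ 2) • RI d k N L j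
        (reM (Gps (side k L j) (Mlev d k N L j) a') ⊗ₖ (1 : Matrix (Fin (d + 1)) (Fin (d + 1)) ℝ))) = 1 ∧
    (((side k L j : ℝ) ^ 2) • RI d k N L j
        (reM (Gps (side k L j) (Mlev d k N L j) a') ⊗ₖ (1 : Matrix (Fin (d + 1)) (Fin (d + 1)) ℝ)))
      * (stencilE d k N L + (a' * ((side k L j : ℝ) ^ 2)⁻¹) • RI d k N L j
        (reM (PiS (side k L j) (Mlev d k N L j)) ⊗ₖ (1 : Matrix (Fin (d + 1)) (Fin (d + 1)) ℝ))) = 1 := by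
  rw [← scaledDeltaPs_kron_eq]
  exact ⟨Ks_mul_Gs d k N L j ha', Gs_mul_Ks d k N L j ha'⟩

end Operator

end Summit.QuantumFields.BalabanUV.Beta.GAN24.ScalarFlatLift
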